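import Literature.Probability.LatticeModels.ProdBernoulliIndependence
import HarnessLib

/-!
# QUANT lane R8: the three-witness inequality — layer one of FAR for three ancestral chains

builds on p205010 (kernel theorem, internal audit signed; external expert review pending)

Support file (`--supports stmt-CriticalPhenomena-4575`), QUANT lane lead (gen 7), rung R8 of
`run/shared/lean/prim/quant/LADDER.md`; memo `prim-quant-lead-g7/LEAD-NOTES-G7.md` N15.  Theorems only; no
definitions, no sorries, standard axioms.

**Setting (gate coordinates).**  `prodBernoulli q` on `Set ι` (each `i` present independently with probability `q i`);
for a finite set `S` the event "`S` is open" is `{ω | ↑S ⊆ ω}`, of probability `π S := ∏_{i∈S} q i`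
(`prodBernoulli_real_subset`).  On a rooted tree in gate coordinates a relay `a` is reached iff its ancestral chain `A`
is open; three relays `a, b, c` give three chains `A, B, C`, and chains of a tree are LAMINAR: two of the three
pairwise intersections coincide and the third pair meets only inside the first chain.  We use the laminarity in
the form of the trichotomy
`(A ∩ B = A ∩ C) ∨ (A ∩ B ⊆ A ∩ C ∧ B ∩ C ⊆ A) ∨ (A ∩ C ⊆ A ∩ B ∧ B ∩ C ⊆ A)`.

* `Quant.triple_prod_ineq` — **the three-witness product inequality**: for finsets `A, B, C` with weights in `[0,1]`,
  laminar as above, with `π A ≤ π B`, `π A ≤ π C` and `1 ≤ π B + π C`: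
  `π A + 2·π(A ∪ B ∪ C) ≤ π(A ∪ B) + π(A ∪ C) + π(B ∪ C)`.
  Proof: write `σ = π(A ∩ (B ∪ C))`, `x = π(A \ (B ∪ C))`, `Y = π(B \ A)`, `Z = π(C \ A)`, `V = π((B ∪ C) \ A)`; the claim is
  `σ·[x(1 − Y − Z) − (1 − 2x)V] ≤ 0`.  If `x ≤ 1/2` both terms are `≤ 0` (`Y + Z ≥ π B + π C ≥ 1`).  If `x > 1/2`: in the
  symmetric case `Y, Z ≥ x` and `V ≤ min(Y, Z)`; in the lopsided case `V = Y·Z` and the shape inequality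
  `x(1−Y)(1−Z) ≤ (1−x)YZ` follows from `Z ≥ x`, `Y ≥ σx`, `σZ + Y ≥ 1` (`Quant.triple_shape_ineq`).
* `Quant.prodBernoulli_twoOfThree_ge` — **probability form**: under the same hypotheses,
  `π A ≤ P(at least two of the three chains are open)`.  With `a` the least likely relay this is the exchange
  `P(only a) ≤ P(b and c but not a)`, i.e. LAYER ONE OF FAR (`Quant.FarRelayRow`, `j = 1`) FOR THREE RELAYS ON A TREE whenever the
  two companions satisfy `q_b + q_c ≥ 1` — in particular whenever all three marginals are `≥ 1/2` (the row MAJORITY(3),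
  which is FALSE on general graphs from five vertices: `Quant.majorityRow_false_layerOne`, p218981).  No hypothesis on the mean.
* `Quant.prodBernoulli_card_le_one_le` — counting form: for a finite family of chains containing three such chains,
  `P(#{open chains} ≤ 1) ≤ 1 − π A`.
The tree instances (ancestral chains of `par`/`depth` trees are laminar) and the transfer to the route's vocabulary
(`Quant.tree_relayCount_transfer`, p219638) are in the companion file `…QuantFarTreeLayerOne.lean`.

Paper proofs of the `≥ 1/2` case (three Steiner shapes): prim-quant-p1 g4, P1-SURPLUS §14.3; prim-quant-stmt g8, LAYER1-TREES.md;
the weaker companion hypothesis `q_b + q_c ≥ 1` and the shape-free laminar form are this file's.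
Exact check (lead g7, work/explore): 384 321 random three-relay trees incl. weight-1 and weight-½ gates, 0 violations, 6 112 equalities.
[cite: KozmaNitzan2024, Lemma 2 (p. 6), Conjecture 3 (p. 15)] (context: layer one of the gluing rows); the inequality itself [this work].
-/

noncomputable section

namespace Summit.CriticalPhenomena.PercolationContinuityZ3.Theorems

namespace Quant

open Finset MeasureTheory
open Literature.Probability.LatticeModels
open scoped Classical

/-! ### Real inequalities -/

/-- **Shape inequality** (the lopsided case): for `x, Y, Z, σ ∈ [0,1]` with `x ≤ Z`, `σ·x ≤ Y` and `1 ≤ σ·Z + Y`,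
`x(1 − Y)(1 − Z) ≤ (1 − x)·Y·Z`.  (If `Y ≥ 1/2`: multiply `x(1−Z) ≤ (1−x)Z` by `1 − Y ≤ Y`; if `Y ≤ 1/2`:
`(1−Y)(1−Z) ≤ (σ − Y)Z` and `σ x ≤ Y`.) [this work] -/
theorem triple_shape_ineq (x Y Z σ : ℝ) (hx0 : 0 ≤ x) (hY1 : Y ≤ 1) (hZ0 : 0 ≤ Z) (hZ1 : Z ≤ 1)
    (hxZ : x ≤ Z) (hσx : σ * x ≤ Y) (hsum : 1 ≤ σ * Z + Y) :
    x * (1 - Y) * (1 - Z) ≤ (1 - x) * Y * Z := by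
  by_cases hY : 1 / 2 ≤ Y
  · -- `x(1−Z) ≤ (1−x)Z` and `1 − Y ≤ Y`
    have h1 : x * (1 - Z) ≤ (1 - x) * Z := by nlinarith
    have h2 : 1 - Y ≤ Y := by linarith
    calc x * (1 - Y) * (1 - Z) = (x * (1 - Z)) * (1 - Y) := by ring
      _ ≤ ((1 - x) * Z) * (1 - Y) := mul_le_mul_of_nonneg_right h1 (by linarith)
      _ ≤ ((1 - x) * Z) * Y := mul_le_mul_of_nonneg_left h2 (by nlinarith)
      _ = (1 - x) * Y * Z := by ring
  · push Not at hY
    -- `(1−Y)(1−Z) ≤ (σ−Y)Z` since `σZ + Y ≥ 1` and `Y ≤ 1/2`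
    have h1 : (1 - Y) * (1 - Z) ≤ (σ - Y) * Z := by nlinarith
    calc x * (1 - Y) * (1 - Z) = x * ((1 - Y) * (1 - Z)) := by ring
      _ ≤ x * ((σ - Y) * Z) := mul_le_mul_of_nonneg_left h1 hx0
      _ = (σ * x) * Z - x * Y * Z := by ring
      _ ≤ Y * Z - x * Y * Z := by nlinarith [mul_le_mul_of_nonneg_right hσx hZ0]
      _ = (1 - x) * Y * Z := by ring

/-- Core inequality, low case: `x ≤ 1/2`, `Y + Z ≥ 1`, `V ≥ 0` give `x + 2xV ≤ xY + xZ + V`. [this work] -/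
theorem triple_core_low (x Y Z V : ℝ) (hx0 : 0 ≤ x) (hx : x ≤ 1 / 2) (hV0 : 0 ≤ V) (hYZ : 1 ≤ Y + Z) :
    x + 2 * x * V ≤ x * Y + x * Z + V := by nlinarith

/-- Core inequality, symmetric case: `x ≤ Y`, `x ≤ Z`, `V ≤ Y`, `V ≤ Z`, `1/2 ≤ x` give `x + 2xV ≤ xY + xZ + V`. [this work] -/
theorem triple_core_sym (x Y Z V : ℝ) (hx : 1 / 2 ≤ x) (hxY : x ≤ Y) (hxZ : x ≤ Z) (hVY : V ≤ Y)
    (hVZ : V ≤ Z) : x + 2 * x * V ≤ x * Y + x * Z + V := by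
  rcases le_total Y Z with hYZ | hZY
  · -- worst case `V = Y`: `Y(1−2x) + x(Y+Z−1) = (Y − x) + x(Z − Y) ≥ 0`
    nlinarith
  · nlinarith

/-! ### Finset products -/

variable {ι : Type*}

/-- Products of `[0,1]`-weights are in `[0,1]`. [folklore] -/
theorem prod_unit_nonneg (q : ι → unitInterval) (S : Finset ι) : 0 ≤ ∏ i ∈ S, (q i : ℝ) :=
  Finset.prod_nonneg fun i _ => (q i).2.1

/-- Products of `[0,1]`-weights are at most one. [folklore] -/
theorem prod_unit_le_one (q : ι → unitInterval) (S : Finset ι) : ∏ i ∈ S, (q i : ℝ) ≤ 1 :=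
  Finset.prod_le_one (fun i _ => (q i).2.1) fun i _ => (q i).2.2

/-- Products of `[0,1]`-weights are antitone in the index set. [folklore] -/
theorem prod_unit_anti (q : ι → unitInterval) {S T : Finset ι} (h : S ⊆ T) :
    ∏ i ∈ T, (q i : ℝ) ≤ ∏ i ∈ S, (q i : ℝ) :=
  Finset.prod_le_prod_of_subset_of_le_one h (fun i _ => (q i).2.1) fun i _ _ => (q i).2.2

/-- Splitting a product along a second set: `π S = π(S ∩ T) · π(S \ T)`. [folklore] -/
theorem prod_unit_split (q : ι → unitInterval) (S T : Finset ι) :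
    ∏ i ∈ S, (q i : ℝ) = (∏ i ∈ S ∩ T, (q i : ℝ)) * ∏ i ∈ S \ T, (q i : ℝ) :=
  (Finset.prod_inter_mul_prod_sdiff S T _).symm

/-- `π(S ∪ T) = π S · π(T \ S)`. [folklore] -/
theorem prod_unit_union (q : ι → unitInterval) (S T : Finset ι) :
    ∏ i ∈ S ∪ T, (q i : ℝ) = (∏ i ∈ S, (q i : ℝ)) * ∏ i ∈ T \ S, (q i : ℝ) := by
  rw [← Finset.prod_union Finset.disjoint_sdiff, Finset.union_sdiff_self_eq_union]

/-- **The three-witness product inequality.**  Finsets `A, B, C`, weights `q ∈ [0,1]`, `π S = ∏_{i∈S} q i`; if the three sets are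
laminar in the sense `(A ∩ B = A ∩ C) ∨ (A ∩ B ⊆ A ∩ C ∧ B ∩ C ⊆ A) ∨ (A ∩ C ⊆ A ∩ B ∧ B ∩ C ⊆ A)` (ancestral chains of three vertices
of a rooted tree always are), `π A ≤ π B`, `π A ≤ π C` and `1 ≤ π B + π C`, then
`π A + 2 π(A ∪ B ∪ C) ≤ π(A ∪ B) + π(A ∪ C) + π(B ∪ C)`. [this work] -/
theorem triple_prod_ineq (q : ι → unitInterval) (A B C : Finset ι)
    (hlam : (A ∩ B = A ∩ C) ∨ (A ∩ B ⊆ A ∩ C ∧ B ∩ C ⊆ A) ∨ (A ∩ C ⊆ A ∩ B ∧ B ∩ C ⊆ A))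
    (hAB : ∏ i ∈ A, (q i : ℝ) ≤ ∏ i ∈ B, (q i : ℝ)) (hAC : ∏ i ∈ A, (q i : ℝ) ≤ ∏ i ∈ C, (q i : ℝ))
    (hsum : 1 ≤ (∏ i ∈ B, (q i : ℝ)) + ∏ i ∈ C, (q i : ℝ)) :
    (∏ i ∈ A, (q i : ℝ)) + 2 * ∏ i ∈ A ∪ B ∪ C, (q i : ℝ) ≤
      (∏ i ∈ A ∪ B, (q i : ℝ)) + (∏ i ∈ A ∪ C, (q i : ℝ)) + ∏ i ∈ B ∪ C, (q i : ℝ) := by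
  -- A lemma symmetric in `B`, `C` covering the cases `A ∩ B = A ∩ C` and `A ∩ B ⊆ A ∩ C ∧ B ∩ C ⊆ A`.
  have key : ∀ B C : Finset ι, (A ∩ B = A ∩ C ∨ (A ∩ B ⊆ A ∩ C ∧ B ∩ C ⊆ A)) →
      (∏ i ∈ A, (q i : ℝ) ≤ ∏ i ∈ B, (q i : ℝ)) → (∏ i ∈ A, (q i : ℝ) ≤ ∏ i ∈ C, (q i : ℝ)) →
      (1 ≤ (∏ i ∈ B, (q i : ℝ)) + ∏ i ∈ C, (q i : ℝ)) →
      (∏ i ∈ A, (q i : ℝ)) + 2 * ∏ i ∈ A ∪ B ∪ C, (q i : ℝ) ≤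
        (∏ i ∈ A ∪ B, (q i : ℝ)) + (∏ i ∈ A ∪ C, (q i : ℝ)) + ∏ i ∈ B ∪ C, (q i : ℝ) := by
    intro B C hcase hAB hAC hsum
    -- coordinates
    set σ : ℝ := ∏ i ∈ A ∩ (B ∪ C), (q i : ℝ) with hσ
    set x : ℝ := ∏ i ∈ A \ (B ∪ C), (q i : ℝ) with hx
    set Y : ℝ := ∏ i ∈ B \ A, (q i : ℝ) with hY
    set Z : ℝ := ∏ i ∈ C \ A, (q i : ℝ) with hZ
    set V : ℝ := ∏ i ∈ (B ∪ C) \ A, (q i : ℝ) with hV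
    have hσ0 : 0 ≤ σ := prod_unit_nonneg q _
    have hx0 : 0 ≤ x := prod_unit_nonneg q _
    have hx1 : x ≤ 1 := prod_unit_le_one q _
    have hY1 : Y ≤ 1 := prod_unit_le_one q _
    have hZ0 : 0 ≤ Z := prod_unit_nonneg q _
    have hZ1 : Z ≤ 1 := prod_unit_le_one q _
    have hV0 : 0 ≤ V := prod_unit_nonneg q _
    -- the five products in coordinates
    have eA : ∏ i ∈ A, (q i : ℝ) = σ * x := prod_unit_split q A (B ∪ C)
    have eAB : ∏ i ∈ A ∪ B, (q i : ℝ) = σ * x * Y := by rw [prod_unit_union, eA]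
    have eAC : ∏ i ∈ A ∪ C, (q i : ℝ) = σ * x * Z := by rw [prod_unit_union, eA]
    have eABC : ∏ i ∈ A ∪ B ∪ C, (q i : ℝ) = σ * x * V := by rw [Finset.union_assoc, prod_unit_union, eA]
    have eBC : ∏ i ∈ B ∪ C, (q i : ℝ) = σ * V := by
      rw [prod_unit_split q (B ∪ C) A, Finset.inter_comm]
    -- `π B = π(B ∩ A)·Y ≤ Y`, `π C ≤ Z`
    have eB : ∏ i ∈ B, (q i : ℝ) = (∏ i ∈ B ∩ A, (q i : ℝ)) * Y := prod_unit_split q B A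
    have eC : ∏ i ∈ C, (q i : ℝ) = (∏ i ∈ C ∩ A, (q i : ℝ)) * Z := prod_unit_split q C A
    have hBY : ∏ i ∈ B, (q i : ℝ) ≤ Y := by
      rw [eB]; exact mul_le_of_le_one_left (prod_unit_nonneg q _) (prod_unit_le_one q _)
    have hCZ : ∏ i ∈ C, (q i : ℝ) ≤ Z := by
      rw [eC]; exact mul_le_of_le_one_left (prod_unit_nonneg q _) (prod_unit_le_one q _)
    have hYZ : 1 ≤ Y + Z := by linarith
    -- `V ≤ Y`, `V ≤ Z`
    have hVY : V ≤ Y := prod_unit_anti q (Finset.sdiff_subset_sdiff Finset.subset_union_left le_rfl)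
    have hVZ : V ≤ Z := prod_unit_anti q (Finset.sdiff_subset_sdiff Finset.subset_union_right le_rfl)
    -- target in coordinates: `σ (x + 2 x V) ≤ σ (x Y + x Z + V)`
    rw [eA, eAB, eAC, eABC, eBC]
    suffices h : x + 2 * x * V ≤ x * Y + x * Z + V by nlinarith
    by_cases hxh : x ≤ 1 / 2
    · exact triple_core_low x Y Z V hx0 hxh hV0 hYZ
    push Not at hxh
    -- from here `x > 1/2`, so `σ > 0` may be assumed where needed via `σ x ≤ ...`
    rcases hcase with hα | ⟨hβ1, hβ2⟩
    · -- symmetric case: `A ∩ B = A ∩ C = A ∩ (B ∪ C)`, so `π B = σ Y`, `π C = σ Z`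
      have hS1 : A ∩ (B ∪ C) = A ∩ B := by rw [Finset.inter_union_distrib_left, ← hα, Finset.union_idempotent]
      have eB' : ∏ i ∈ B, (q i : ℝ) = σ * Y := by rw [eB, Finset.inter_comm, ← hS1]
      have eC' : ∏ i ∈ C, (q i : ℝ) = σ * Z := by rw [eC, Finset.inter_comm, ← hα, ← hS1]
      -- `σ x ≤ σ Y`, `σ x ≤ σ Z`; if `σ = 0` the reduced claim still needs `x ≤ Y`: use `σ > 0` or conclude directly
      by_cases hσp : 0 < σ
      · have hxY : x ≤ Y := le_of_mul_le_mul_left (by rw [← eA, ← eB']; exact hAB) hσp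
        have hxZ : x ≤ Z := le_of_mul_le_mul_left (by rw [← eA, ← eC']; exact hAC) hσp
        exact triple_core_sym x Y Z V hxh.le hxY hxZ hVY hVZ
      · -- `σ = 0`: then `π B = 0`, `π C = 0`, contradicting `1 ≤ π B + π C`
        have hσz : σ = 0 := le_antisymm (not_lt.1 hσp) hσ0
        rw [eB', eC', hσz] at hsum
        linarith
    · -- lopsided case: `A ∩ (B ∪ C) = A ∩ C`, `(B \ A) ∩ (C \ A) = ∅` so `V = Y Z`
      have hS1 : A ∩ (B ∪ C) = A ∩ C := by
        rw [Finset.inter_union_distrib_left]; exact Finset.union_eq_right.2 hβ1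
      have eC' : ∏ i ∈ C, (q i : ℝ) = σ * Z := by rw [eC, Finset.inter_comm, ← hS1]
      have hdisj : Disjoint (B \ A) (C \ A) := by
        rw [Finset.disjoint_left]
        intro i hiB hiC
        rw [Finset.mem_sdiff] at hiB hiC
        exact hiB.2 (hβ2 (Finset.mem_inter.2 ⟨hiB.1, hiC.1⟩))
      have eV : V = Y * Z := by
        rw [hV, Finset.union_sdiff_distrib, Finset.prod_union hdisj]
      -- `Y ≥ σ x` from `π B ≥ π A` and `π(B ∩ A) ≤ 1`
      have hσxY : σ * x ≤ Y := le_trans (by rw [← eA]; exact hAB) hBY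
      by_cases hσp : 0 < σ
      · have hxZ : x ≤ Z := le_of_mul_le_mul_left (by rw [← eA, ← eC']; exact hAC) hσp
        have hsum' : 1 ≤ σ * Z + Y := by rw [← eC']; linarith
        have hshape := triple_shape_ineq x Y Z σ hx0 hY1 hZ0 hZ1 hxZ hσxY hsum'
        rw [eV]
        nlinarith
      · have hσz : σ = 0 := le_antisymm (not_lt.1 hσp) hσ0
        -- `π C = 0` forces `π B ≥ 1`, so `Y ≥ 1`, `Y = 1`; then the claim is `x + 2xZ ≤ x + xZ + Z`, i.e. `xZ ≤ Z`
        have hB1 : 1 ≤ ∏ i ∈ B, (q i : ℝ) := by rw [eC', hσz] at hsum; linarith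
        have hY1' : Y = 1 := le_antisymm hY1 (hB1.trans hBY)
        rw [eV, hY1']
        nlinarith
  rcases hlam with hα | hβ | hγ
  · exact key B C (Or.inl hα) hAB hAC hsum
  · exact key B C (Or.inr hβ) hAB hAC hsum
  · -- swap the roles of `B` and `C`
    have h := key C B (Or.inr ⟨hγ.1, by rw [Finset.inter_comm]; exact hγ.2⟩) hAC hAB (by linarith)
    have e1 : A ∪ C ∪ B = A ∪ B ∪ C := by rw [Finset.union_assoc, Finset.union_comm C B, ← Finset.union_assoc]
    rw [e1, Finset.union_comm C B] at h
    linarith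

/-! ### Probability form -/

/-- The event "all of `S` present": `{ω | ↑S ⊆ ω}`; intersections of two such events. [folklore] -/
theorem setOf_subset_inter (S T : Finset ι) :
    ({ω : Set ι | (S : Set ι) ⊆ ω} ∩ {ω | (T : Set ι) ⊆ ω}) = {ω | ((S ∪ T : Finset ι) : Set ι) ⊆ ω} := by
  ext ω
  simp only [Set.mem_inter_iff, Set.mem_setOf_eq, Finset.coe_union, Set.union_subset_iff]

/-- **Two of three chains are open with probability at least `π A`.**  Under `prodBernoulli q` on `Set ι`, for finsets `A, B, C`
laminar as in `triple_prod_ineq`, with `π A ≤ π B`, `π A ≤ π C`, `1 ≤ π B + π C`: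
`π A ≤ P({A, B open} ∪ {A, C open} ∪ {B, C open})`.  Layer one of FAR for three relays on a tree (exchange
`P(only a) ≤ P(b, c, not a)`), in particular MAJORITY(3) on trees (all three marginals `≥ 1/2`). [this work] -/
theorem prodBernoulli_twoOfThree_ge [Finite ι] (q : ι → unitInterval) (A B C : Finset ι)
    (hlam : (A ∩ B = A ∩ C) ∨ (A ∩ B ⊆ A ∩ C ∧ B ∩ C ⊆ A) ∨ (A ∩ C ⊆ A ∩ B ∧ B ∩ C ⊆ A))
    (hAB : ∏ i ∈ A, (q i : ℝ) ≤ ∏ i ∈ B, (q i : ℝ)) (hAC : ∏ i ∈ A, (q i : ℝ) ≤ ∏ i ∈ C, (q i : ℝ))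
    (hsum : 1 ≤ (∏ i ∈ B, (q i : ℝ)) + ∏ i ∈ C, (q i : ℝ)) :
    ∏ i ∈ A, (q i : ℝ) ≤
      (prodBernoulli q).real (({ω : Set ι | (A : Set ι) ⊆ ω} ∩ {ω | (B : Set ι) ⊆ ω}) ∪
        ({ω : Set ι | (A : Set ι) ⊆ ω} ∩ {ω | (C : Set ι) ⊆ ω}) ∪
        ({ω : Set ι | (B : Set ι) ⊆ ω} ∩ {ω | (C : Set ι) ⊆ ω})) := by
  set μ := prodBernoulli q with hμ
  have hmeas : ∀ S : Set (Set ι), MeasurableSet S := fun S => (Set.toFinite S).measurableSet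
  -- the events `E S = {S open}` and their probabilities
  set E : Finset ι → Set (Set ι) := fun S => {ω | (S : Set ι) ⊆ ω} with hE
  have hP : ∀ S, μ.real (E S) = ∏ i ∈ S, (q i : ℝ) := fun S => prodBernoulli_real_subset q S
  have hEE : ∀ S T, E S ∩ E T = E (S ∪ T) := fun S T => setOf_subset_inter S T
  -- rewrite the target event as `E(A∪B) ∪ E(A∪C) ∪ E(B∪C)`
  have hG : (({ω : Set ι | (A : Set ι) ⊆ ω} ∩ {ω | (B : Set ι) ⊆ ω}) ∪
        ({ω : Set ι | (A : Set ι) ⊆ ω} ∩ {ω | (C : Set ι) ⊆ ω}) ∪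
        ({ω : Set ι | (B : Set ι) ⊆ ω} ∩ {ω | (C : Set ι) ⊆ ω})) = E (A ∪ B) ∪ E (A ∪ C) ∪ E (B ∪ C) := by
    rw [← hEE A B, ← hEE A C, ← hEE B C]
  rw [hG]
  -- `E(A∪B) ∪ E(A∪C)` and `H = E(B∪C) \ E(A∪B∪C)` are disjoint pieces of the target
  set U : Set (Set ι) := E (A ∪ B) ∪ E (A ∪ C) with hU
  set H : Set (Set ι) := E (B ∪ C) \ E (A ∪ B ∪ C) with hH
  have hUint : E (A ∪ B) ∩ E (A ∪ C) = E (A ∪ B ∪ C) := by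
    rw [hEE]; congr 1; ext i; simp only [Finset.mem_union]; tauto
  have hU_val : μ.real U = (∏ i ∈ A ∪ B, (q i : ℝ)) + (∏ i ∈ A ∪ C, (q i : ℝ)) - ∏ i ∈ A ∪ B ∪ C, (q i : ℝ) := by
    have h := measureReal_union_add_inter (μ := μ) (s := E (A ∪ B)) (t := E (A ∪ C)) (hmeas _)
    rw [hUint, hP, hP, hP] at h
    rw [hU]; linarith
  have hsubH : E (A ∪ B ∪ C) ⊆ E (B ∪ C) := by
    intro ω hω
    simp only [hE, Set.mem_setOf_eq, Finset.coe_union, Set.union_subset_iff] at hω ⊢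
    exact ⟨hω.1.2, hω.2⟩
  have hH_val : μ.real H = (∏ i ∈ B ∪ C, (q i : ℝ)) - ∏ i ∈ A ∪ B ∪ C, (q i : ℝ) := by
    rw [hH, measureReal_sdiff hsubH (hmeas _), hP, hP]
  have hdisj : Disjoint U H := by
    rw [Set.disjoint_left]
    intro ω hωU hωH
    rw [hH, Set.mem_sdiff] at hωH
    apply hωH.2
    have hω2 : ω ∈ E (B ∪ C) := hωH.1
    simp only [hU, Set.mem_union, hE, Set.mem_setOf_eq, Finset.coe_union, Set.union_subset_iff] at hωU hω2 ⊢
    rcases hωU with h | h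
    · exact ⟨⟨h.1, h.2⟩, hω2.2⟩
    · exact ⟨⟨h.1, hω2.1⟩, h.2⟩
  have hsub : U ∪ H ⊆ E (A ∪ B) ∪ E (A ∪ C) ∪ E (B ∪ C) := by
    intro ω hω
    rcases hω with hω | hω
    · exact Or.inl hω
    · rw [hH, Set.mem_sdiff] at hω
      exact Or.inr hω.1
  have hkey := triple_prod_ineq q A B C hlam hAB hAC hsum
  calc ∏ i ∈ A, (q i : ℝ)
      ≤ μ.real U + μ.real H := by rw [hU_val, hH_val]; linarith
    _ = μ.real (U ∪ H) := (measureReal_union hdisj (hmeas _)).symm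
    _ ≤ μ.real (E (A ∪ B) ∪ E (A ∪ C) ∪ E (B ∪ C)) := measureReal_mono hsub (measure_ne_top _ _)

/-- **Counting form.**  For a finite family of chains `T x` (`x ∈ R`) containing three pairwise distinct members `a, b, c` whose
chains satisfy the hypotheses of `prodBernoulli_twoOfThree_ge`: `P(#{x ∈ R | T x open} ≤ 1) ≤ 1 − π(T a)` — at most one
open chain is no more likely than missing the least likely of the three witnesses. [this work] -/
theorem prodBernoulli_card_le_one_le [Finite ι] {κ : Type*} (q : ι → unitInterval) (T : κ → Finset ι)
    (R : Finset κ) {a b c : κ} (ha : a ∈ R) (hb : b ∈ R) (hc : c ∈ R) (hab : a ≠ b) (hac : a ≠ c) (hbc : b ≠ c)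
    (hlam : (T a ∩ T b = T a ∩ T c) ∨ (T a ∩ T b ⊆ T a ∩ T c ∧ T b ∩ T c ⊆ T a) ∨
      (T a ∩ T c ⊆ T a ∩ T b ∧ T b ∩ T c ⊆ T a))
    (hAB : ∏ i ∈ T a, (q i : ℝ) ≤ ∏ i ∈ T b, (q i : ℝ)) (hAC : ∏ i ∈ T a, (q i : ℝ) ≤ ∏ i ∈ T c, (q i : ℝ))
    (hsum : 1 ≤ (∏ i ∈ T b, (q i : ℝ)) + ∏ i ∈ T c, (q i : ℝ)) :
    (prodBernoulli q).real {ω : Set ι | (R.filter fun x => ((T x : Finset ι) : Set ι) ⊆ ω).card ≤ 1} ≤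
      1 - ∏ i ∈ T a, (q i : ℝ) := by
  set μ := prodBernoulli q with hμ
  have hmeas : ∀ S : Set (Set ι), MeasurableSet S := fun S => (Set.toFinite S).measurableSet
  set G : Set (Set ι) := ({ω : Set ι | ((T a : Finset ι) : Set ι) ⊆ ω} ∩ {ω | ((T b : Finset ι) : Set ι) ⊆ ω}) ∪
        ({ω : Set ι | ((T a : Finset ι) : Set ι) ⊆ ω} ∩ {ω | ((T c : Finset ι) : Set ι) ⊆ ω}) ∪
        ({ω : Set ι | ((T b : Finset ι) : Set ι) ⊆ ω} ∩ {ω | ((T c : Finset ι) : Set ι) ⊆ ω}) with hG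
  have hGge : ∏ i ∈ T a, (q i : ℝ) ≤ μ.real G := prodBernoulli_twoOfThree_ge q (T a) (T b) (T c) hlam hAB hAC hsum
  -- `{# ≤ 1} ⊆ Gᶜ`: two open witnesses give two elements of the filter
  have hsub : {ω : Set ι | (R.filter fun x => ((T x : Finset ι) : Set ι) ⊆ ω).card ≤ 1} ⊆ Gᶜ := by
    intro ω hω hωG
    have hω1 : (R.filter fun x => ((T x : Finset ι) : Set ι) ⊆ ω).card ≤ 1 := hω
    have two : ∀ u v : κ, u ∈ R → v ∈ R → u ≠ v → ((T u : Finset ι) : Set ι) ⊆ ω →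
        ((T v : Finset ι) : Set ι) ⊆ ω → False := by
      intro u v hu hv huv hTu hTv
      have h2 : ({u, v} : Finset κ) ⊆ R.filter fun x => ((T x : Finset ι) : Set ι) ⊆ ω := by
        intro x hx
        rw [Finset.mem_insert, Finset.mem_singleton] at hx
        rw [Finset.mem_filter]
        rcases hx with rfl | rfl
        · exact ⟨hu, hTu⟩
        · exact ⟨hv, hTv⟩
      have := Finset.card_le_card h2
      rw [Finset.card_pair huv] at this
      omega
    simp only [hG, Set.mem_union, Set.mem_inter_iff, Set.mem_setOf_eq] at hωG
    rcases hωG with (⟨h1, h2⟩ | ⟨h1, h2⟩) | ⟨h1, h2⟩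
    · exact two a b ha hb hab h1 h2
    · exact two a c ha hc hac h1 h2
    · exact two b c hb hc hbc h1 h2
  calc μ.real {ω : Set ι | (R.filter fun x => ((T x : Finset ι) : Set ι) ⊆ ω).card ≤ 1}
      ≤ μ.real Gᶜ := measureReal_mono hsub (measure_ne_top _ _)
    _ = 1 - μ.real G := probReal_compl_eq_one_sub (hmeas _)
    _ ≤ 1 - ∏ i ∈ T a, (q i : ℝ) := by linarith

end Quant

end Summit.CriticalPhenomena.PercolationContinuityZ3.Theorems

end
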